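import Mathlib.Analysis.InnerProductSpace.PiL2
import Mathlib.Topology.Homotopy.Contractible
import Mathlib.Algebra.Category.ModuleCat.Biproducts
import Literature.AlgebraicTopology.SingularHomology.SingularChains
import Literature.AlgebraicTopology.SingularHomology.RelativeHomology
import HarnessLib

-- provenance: harness21/H21/H21/Prelude/AlgTop/ExcisionMayerVietoris.lean @ ec52c55 (interim HEAD d8f2665); M5 mechanical rewrite
/-!
# Excision, Mayer–Vietoris and the homology of spheres
(trunk G04 AlgTop, item C3 `ExcisionMayerVietoris`)

Named facts (`def … : Prop`, textbook results not proved here) and honest definitions/lemmas: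

* excision for relative singular homology `Literature.AlgebraicTopology.SingularHomology.relativeSingularHomology`
  (Hatcher, *Algebraic Topology* (2002), Thm. 2.20), in both forms
  `Hₙ(X ∖ U, A ∖ U) ≅ Hₙ(X, A)` for `closure U ⊆ interior A` and
  `Hₙ(B, A ∩ B) ≅ Hₙ(X, A)` for `interior A ∪ interior B = X` — **named facts**
  `isIso_map_of_closure_subset_interior`, `isIso_map_of_interior_union_interior` (explicit `X`);
* the Mayer–Vietoris sequence
  `⋯ ⟶ Hₙ(U ∩ V) ⟶ Hₙ(U) ⊞ Hₙ(V) ⟶ Hₙ(X) ⟶ Hₙ₋₁(U ∩ V) ⟶ ⋯`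
  for `interior U ∪ interior V = X` (Hatcher 2002, §2.2, p. 149): the maps `φ`, `ψ` and the
  connecting map `Literature.AlgebraicTopology.SingularHomology.mayerVietoris.δ` are honest definitions (`δ` takes the excision fact for `X`
  as the explicit hypothesis `hexc`), the complex identities `φ_comp_ψ`, `ψ_comp_δ`, `δ_comp_φ`
  are proved, and exactness `exact₁/₂/₃` and `δ_naturality` are **named facts**;
* the homology of spheres, disks and contractible spaces (Hatcher 2002, Cor. 2.14, Ex. 2.17,
  Lemma 2.19 ff.): contractible spaces are proved, the sphere/disk computations
  `nonempty_singularHomology_sphere_iso`, `isZero_singularHomology_sphere`,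
  `nonempty_relativeSingularHomology_closedBall_sphere_iso` are **named facts**.

Mathlib (pinned) has none of these for singular homology (it has the abstract homology sequence
machinery `CategoryTheory.ShortComplex`, biproducts in `ModuleCat`, `ContractibleSpace`, and
`Metric.sphere`/`EuclideanSpace`); we only state them on top of
`Literature.AlgebraicTopology.SingularHomology.RelativeHomology`.

## Conventions

As in `Literature.AlgebraicTopology.SingularHomology.SingularChains`: `X : Type u` unbundled, coefficients `R : Type v`
`[CommRing R]`, `M : Type v` an `R`-module, all objects in `ModuleCat.{max u v} R`; pairs are
`(X, A : Set X)`, subspaces are subtypes, and a subspace of a subspace `B ⊆ X` is written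
`Subtype.val ⁻¹' A : Set ↥B` (Mathlib's `B ↓∩ A`).

Spheres are the metric spheres `Metric.sphere (0 : EuclideanSpace ℝ (Fin (n + 1))) 1` (local
notation `𝕊 n`, as in `Literature.Statements.SPC4.Wave0`), *not* `TopCat.sphere` (which is `ULift`ed).

## Sign convention for Mayer–Vietoris

We follow Hatcher 2002, §2.2: `φ x = (i_U* x, -i_V* x)`, `ψ (x, y) = j_U* x + j_V* y`, and the
connecting map `δ : Hₙ₊₁(X) ⟶ Hₙ(U ∩ V)` is the composite
`Hₙ₊₁(X) ⟶ Hₙ₊₁(X, V) ≅ Hₙ₊₁(U, U ∩ V) ⟶ Hₙ(U ∩ V)` through the excision isomorphism of the map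
of pairs `(U, U ∩ V) → (X, V)`; on a cycle `z = x + y` with `x` a chain in `U` and `y` a chain in
`V` this is `δ [z] = [∂x]`, which is Hatcher's `∂`.

## Main statements

* `Literature.AlgebraicTopology.SingularHomology.relativeSingularHomology.isIso_map_of_closure_subset_interior` (excision, Thm. 2.20).
* `Literature.AlgebraicTopology.SingularHomology.relativeSingularHomology.isIso_map_of_interior_union_interior` (excision, second form).
* `Literature.AlgebraicTopology.SingularHomology.mayerVietoris.δ`, `Literature.mayerVietoris.exact₁/₂/₃`, `Literature.AlgebraicTopology.SingularHomology.mayerVietoris.δ_naturality`.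
* `Literature.AlgebraicTopology.SingularHomology.nonempty_singularHomology_sphere_iso`, `Literature.AlgebraicTopology.SingularHomology.isZero_singularHomology_sphere`,
  `Literature.AlgebraicTopology.SingularHomology.isZero_singularHomology_of_contractibleSpace`,
  `Literature.AlgebraicTopology.SingularHomology.singularHomology.isIso_ε_of_contractibleSpace`,
  `Literature.AlgebraicTopology.SingularHomology.nonempty_relativeSingularHomology_closedBall_sphere_iso`.

## References

* A. Hatcher, *Algebraic Topology*, CUP 2002, §2.1–2.2.
-/

noncomputable section

open CategoryTheory Limits AlgebraicTopology

universe u v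

namespace Literature.AlgebraicTopology.SingularHomology

variable (R : Type v) [CommRing R] (M : Type v) [AddCommGroup M] [Module R M]
variable {X Y : Type u} [TopologicalSpace X] [TopologicalSpace Y]

/-! ### Inclusions of subspaces -/

/-- The inclusion `A ↪ X` of a subspace as a continuous map (Hatcher 2002, §2.1); bundles
`Subtype.val` with `continuous_subtype_val`. [cite: Hatcher2002, §2.1] -/
abbrev subsetIncl (A : Set X) : C(A, X) := ⟨Subtype.val, continuous_subtype_val⟩

/-- The inclusion `A ↪ B` of nested subspaces `A ⊆ B` of `X` as a continuous map
(Hatcher 2002, §2.1); bundles `Set.inclusion` with `continuous_inclusion`. [cite: Hatcher2002, §2.1] -/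
abbrev subsetInclusion {A B : Set X} (h : A ⊆ B) : C(A, B) := ⟨Set.inclusion h, continuous_inclusion h⟩

/-- The tautological homeomorphism `{x : U // ↑x ∈ V} ≃ₜ ↥(U ∩ V)` identifying the subspace
`U ↓∩ V` of the subspace `U` with the subspace `U ∩ V` of `X` (Hatcher 2002, §2.2: the pair
`(U, U ∩ V)`). [cite: Hatcher2002, §2.2] -/
@[simps]
def preimageValHomeomorph (U V : Set X) : ↥(Subtype.val ⁻¹' V : Set U) ≃ₜ ↥(U ∩ V) where
  toFun x := ⟨x.1.1, x.1.2, x.2⟩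
  invFun x := ⟨⟨x.1, x.2.1⟩, x.2.2⟩
  left_inv _ := rfl
  right_inv _ := rfl
  continuous_toFun := by fun_prop
  continuous_invFun := by fun_prop

/-! ### Excision -/

namespace relativeSingularHomology

/-- **Excision** (Hatcher 2002, Thm. 2.20): if `closure U ⊆ interior A` then the inclusion of
pairs `(X ∖ U, A ∖ U) → (X, A)` induces isomorphisms `Hₙ(X ∖ U, A ∖ U; M) ≅ Hₙ(X, A; M)` for all
`n`. Here `X ∖ U` is the subtype `↥Uᶜ` and `A ∖ U` the subset `Subtype.val ⁻¹' A` of it. The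
space `X` is an explicit argument. [cite: Hatcher2002, Thm. 2.20] -/
def isIso_map_of_closure_subset_interior (X : Type u) [TopologicalSpace X] : Prop :=
  ∀ {A U : Set X} (_ : closure U ⊆ interior A) (n : ℕ),
    IsIso (map R M (X := ↥Uᶜ) (subsetIncl Uᶜ)
      (Set.mapsTo_preimage Subtype.val A : Set.MapsTo _ (Subtype.val ⁻¹' A) A) n)

/-- **Excision**, second form (Hatcher 2002, Thm. 2.20): if the interiors of `A` and `B` cover
`X` then the inclusion of pairs `(B, A ∩ B) → (X, A)` induces isomorphisms
`Hₙ(B, A ∩ B; M) ≅ Hₙ(X, A; M)` for all `n`. Here `A ∩ B` is the subset `Subtype.val ⁻¹' A` of the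
subtype `↥B`. The space `X` is an explicit argument. [cite: Hatcher2002, Thm. 2.20] -/
def isIso_map_of_interior_union_interior (X : Type u) [TopologicalSpace X] : Prop :=
  ∀ (A B : Set X) (_ : interior A ∪ interior B = Set.univ) (n : ℕ),
    IsIso (map R M (X := ↥B) (subsetIncl B)
      (Set.mapsTo_preimage Subtype.val A : Set.MapsTo _ (Subtype.val ⁻¹' A) A) n)

end relativeSingularHomology

/-! ### The Mayer–Vietoris sequence -/

namespace mayerVietoris

variable (U V : Set X)

/-- The first map `φ : Hₙ(U ∩ V) ⟶ Hₙ(U) ⊞ Hₙ(V)`, `φ x = (i_U* x, -i_V* x)`, of the Mayer–Vietoris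
sequence (Hatcher 2002, §2.2, p. 149; sign convention as there). [cite: Hatcher2002, §2.2 p. 149] -/
def φ (n : ℕ) : singularHomology R M ↥(U ∩ V) n ⟶
    singularHomology R M U n ⊞ singularHomology R M V n :=
  biprod.lift (singularHomology.map R M (subsetInclusion Set.inter_subset_left) n)
    (-singularHomology.map R M (subsetInclusion Set.inter_subset_right) n)

/-- The second map `ψ : Hₙ(U) ⊞ Hₙ(V) ⟶ Hₙ(X)`, `ψ (x, y) = j_U* x + j_V* y`, of the Mayer–Vietoris
sequence (Hatcher 2002, §2.2, p. 149). [cite: Hatcher2002, §2.2 p. 149] -/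
def ψ (n : ℕ) : singularHomology R M U n ⊞ singularHomology R M V n ⟶ singularHomology R M X n :=
  biprod.desc (singularHomology.map R M (subsetIncl U) n) (singularHomology.map R M (subsetIncl V) n)

/-- The map of pairs `(U, U ∩ V) → (X, V)` on relative homology,
`Hₙ(U, U ∩ V; M) ⟶ Hₙ(X, V; M)`; an isomorphism when `interior U ∪ interior V = X` by excision
(Hatcher 2002, §2.2, p. 150, and Thm. 2.20). [cite: Hatcher2002, Thm. 2.20] -/
abbrev excisionMap (n : ℕ) :
    relativeSingularHomology R M U (Subtype.val ⁻¹' V) n ⟶ relativeSingularHomology R M X V n :=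
  relativeSingularHomology.map R M (X := ↥U) (subsetIncl U)
    (Set.mapsTo_preimage Subtype.val V : Set.MapsTo _ (Subtype.val ⁻¹' V) V) n

/-- `excisionMap` is an isomorphism when the interiors of `U` and `V` cover `X`
(Hatcher 2002, Thm. 2.20); a re-indexing of
`relativeSingularHomology.isIso_map_of_interior_union_interior`, taken as the hypothesis
`hexc`. [cite: Hatcher2002, Thm. 2.20] -/
theorem isIso_excisionMap
    (hexc : relativeSingularHomology.isIso_map_of_interior_union_interior R M X)
    (h : interior U ∪ interior V = Set.univ) (n : ℕ) :
    IsIso (excisionMap R M U V n) :=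
  hexc V U ((Set.union_comm _ _).trans h) n

/-- The connecting homomorphism `δ : Hₙ₊₁(X; M) ⟶ Hₙ(U ∩ V; M)` of the Mayer–Vietoris sequence of
an open-interior cover `interior U ∪ interior V = X` (Hatcher 2002, §2.2, p. 149–150), defined as
the composite `Hₙ₊₁(X) ⟶ Hₙ₊₁(X, V) ≅ Hₙ₊₁(U, U ∩ V) ⟶ Hₙ(U ↓∩ V) ≅ Hₙ(U ∩ V)` (route through the
pair `(U, U ∩ V) → (X, V)`; on a cycle `z = x + y`, `x ∈ C(U)`, `y ∈ C(V)`, `δ [z] = [∂x]`).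
Relies on: `relativeSingularHomology.isIso_map_of_interior_union_interior` (excision for `X`),
taken as the explicit hypothesis `hexc`. [cite: Hatcher2002, §2.2 pp. 149–150] -/
def δ (hexc : relativeSingularHomology.isIso_map_of_interior_union_interior R M X)
    (h : interior U ∪ interior V = Set.univ) (n : ℕ) :
    singularHomology R M X (n + 1) ⟶ singularHomology R M ↥(U ∩ V) n :=
  haveI := isIso_excisionMap R M U V hexc h (n + 1)
  relativeSingularHomology.ofAbsolute R M X V (n + 1) ≫ inv (excisionMap R M U V (n + 1)) ≫
    relativeSingularHomology.δ R M U (Subtype.val ⁻¹' V) n ≫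
      singularHomology.map R M (preimageValHomeomorph U V) n

/-- `φ ≫ ψ = 0`: the two inclusions `U ∩ V ↪ U ↪ X` and `U ∩ V ↪ V ↪ X` agree
(Hatcher 2002, §2.2, p. 149). [cite: Hatcher2002, §2.2 p. 149] -/
@[reassoc (attr := simp)]
lemma φ_comp_ψ (n : ℕ) : φ R M U V n ≫ ψ R M U V n = 0 := by
  simp only [φ, ψ, biprod.lift_desc, Preadditive.neg_comp, ← singularHomology.map_comp]
  exact add_neg_cancel _

/-- `ψ ≫ δ = 0` in the Mayer–Vietoris sequence (Hatcher 2002, §2.2, p. 149): on the `U`-summand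
`j_* i_{U*} = exc ∘ j_*` and `∂ ∘ j_* = 0`; on the `V`-summand `j_* i_{V*} = 0`. [cite: Hatcher2002, §2.2 p. 149] -/
@[reassoc (attr := simp)]
lemma ψ_comp_δ (hexc : relativeSingularHomology.isIso_map_of_interior_union_interior R M X)
    (h : interior U ∪ interior V = Set.univ) (n : ℕ) :
    ψ R M U V (n + 1) ≫ δ R M U V hexc h n = 0 := by
  haveI := isIso_excisionMap R M U V hexc h (n + 1)
  unfold δ
  refine biprod.hom_ext' _ _ ?_ ?_
  · rw [ψ, biprod.inl_desc_assoc, comp_zero,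
      ← relativeSingularHomology.ofAbsolute_comp_map_assoc R M (subsetIncl U)
        (Set.mapsTo_preimage Subtype.val V) (n + 1),
      IsIso.hom_inv_id_assoc, relativeSingularHomology.ofAbsolute_comp_δ_assoc, zero_comp]
  · rw [ψ, biprod.inr_desc_assoc, comp_zero, relativeSingularHomology.map_comp_ofAbsolute_assoc,
      zero_comp]

/-- `δ ≫ φ = 0` in the Mayer–Vietoris sequence (Hatcher 2002, §2.2, p. 149): on the `U`-component
`i ∘ ∂ = 0` for the pair `(U, U ∩ V)`; on the `V`-component naturality of `∂` along
`(U, U ∩ V) → (X, V)` and `∂ ∘ j_* = 0`. [cite: Hatcher2002, §2.2 p. 149] -/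
@[reassoc (attr := simp)]
lemma δ_comp_φ (hexc : relativeSingularHomology.isIso_map_of_interior_union_interior R M X)
    (h : interior U ∪ interior V = Set.univ) (n : ℕ) :
    δ R M U V hexc h n ≫ φ R M U V n = 0 := by
  haveI := isIso_excisionMap R M U V hexc h (n + 1)
  have hU : (subsetInclusion (Set.inter_subset_left : U ∩ V ⊆ U)).comp
      (preimageValHomeomorph U V : C(↥(Subtype.val ⁻¹' V : Set U), ↥(U ∩ V))) =
      subsetIncl (Subtype.val ⁻¹' V : Set U) := by
    ext x; rfl
  have hV : (subsetInclusion (Set.inter_subset_right : U ∩ V ⊆ V)).comp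
      (preimageValHomeomorph U V : C(↥(Subtype.val ⁻¹' V : Set U), ↥(U ∩ V))) =
      subsetRestrict (subsetIncl U) (Set.mapsTo_preimage Subtype.val V) := by
    ext x; rfl
  unfold δ φ
  refine biprod.hom_ext _ _ ?_ ?_
  · rw [Category.assoc, biprod.lift_fst, zero_comp, Category.assoc, Category.assoc, Category.assoc,
      ← singularHomology.map_comp, hU, relativeSingularHomology.δ_comp_map, comp_zero, comp_zero]
  · rw [Category.assoc, biprod.lift_snd, zero_comp, Category.assoc, Category.assoc, Category.assoc]
    simp only [Preadditive.comp_neg, neg_eq_zero]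
    rw [← singularHomology.map_comp, hV, relativeSingularHomology.δ_naturality,
      IsIso.inv_hom_id_assoc, relativeSingularHomology.ofAbsolute_comp_δ]

/-- Exactness of the Mayer–Vietoris sequence at `Hₙ(U) ⊞ Hₙ(V)`:
`Hₙ(U ∩ V) ⟶ Hₙ(U) ⊞ Hₙ(V) ⟶ Hₙ(X)` is exact when `interior U ∪ interior V = X`
(Hatcher 2002, §2.2, p. 149). [cite: Hatcher2002, §2.2 p. 149] -/
def exact₁ : Prop :=
  ∀ (_ : interior U ∪ interior V = Set.univ) (n : ℕ),
    (ShortComplex.mk _ _ (φ_comp_ψ R M U V n)).Exact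

/-- Exactness of the Mayer–Vietoris sequence at `Hₙ₊₁(X)`:
`Hₙ₊₁(U) ⊞ Hₙ₊₁(V) ⟶ Hₙ₊₁(X) ⟶ Hₙ(U ∩ V)` is exact (Hatcher 2002, §2.2, p. 149). [cite: Hatcher2002, §2.2 p. 149] -/
def exact₂ : Prop :=
  ∀ (hexc : relativeSingularHomology.isIso_map_of_interior_union_interior R M X)
    (h : interior U ∪ interior V = Set.univ) (n : ℕ),
    (ShortComplex.mk _ _ (ψ_comp_δ R M U V hexc h n)).Exact

/-- Exactness of the Mayer–Vietoris sequence at `Hₙ(U ∩ V)`: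
`Hₙ₊₁(X) ⟶ Hₙ(U ∩ V) ⟶ Hₙ(U) ⊞ Hₙ(V)` is exact (Hatcher 2002, §2.2, p. 149). [cite: Hatcher2002, §2.2 p. 149] -/
def exact₃ : Prop :=
  ∀ (hexc : relativeSingularHomology.isIso_map_of_interior_union_interior R M X)
    (h : interior U ∪ interior V = Set.univ) (n : ℕ),
    (ShortComplex.mk _ _ (δ_comp_φ R M U V hexc h n)).Exact

/-- Naturality of the Mayer–Vietoris connecting map: for `f : X → Y` with `f '' U ⊆ U'`,
`f '' V ⊆ V'`, `(f|_{U ∩ V})_* ∘ δ = δ ∘ f_*` (Hatcher 2002, §2.2, p. 150, naturality of the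
Mayer–Vietoris sequence); excision for `X` and `Y` are the hypotheses `hexc`, `hexc'`. [cite: Hatcher2002, §2.2 p. 150] -/
def δ_naturality : Prop :=
  ∀ (hexc : relativeSingularHomology.isIso_map_of_interior_union_interior R M X)
    (hexc' : relativeSingularHomology.isIso_map_of_interior_union_interior R M Y)
    {U V : Set X} {U' V' : Set Y} (f : C(X, Y)) (hU : Set.MapsTo f U U') (hV : Set.MapsTo f V V')
    (h : interior U ∪ interior V = Set.univ) (h' : interior U' ∪ interior V' = Set.univ) (n : ℕ),
    δ R M U V hexc h n ≫ singularHomology.map R M (subsetRestrict f (hU.inter_inter hV)) n =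
      singularHomology.map R M f (n + 1) ≫ δ R M U' V' hexc' h' n

end mayerVietoris

/-! ### Contractible spaces, spheres and disks -/

/-- A contractible space has vanishing singular homology in positive degrees
(Hatcher 2002, §2.1, Prop. 2.8 with Cor. 2.11). Proof: homotopy invariance and the point. [cite: Hatcher2002, Prop. 2.8] -/
theorem isZero_singularHomology_of_contractibleSpace [ContractibleSpace X] {n : ℕ} (hn : n ≠ 0) :
    IsZero (singularHomology R M X n) := by
  obtain ⟨e⟩ := ContractibleSpace.hequiv X PUnit.{u + 1}
  exact (isZero_singularHomology_of_subsingleton R M (X := PUnit.{u + 1}) hn).of_iso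
    (singularHomology.isoOfHomotopyEquiv R M e n)

/-- For a contractible space the augmentation `ε : H₀(X; M) ⟶ M` is an isomorphism
(Hatcher 2002, Prop. 2.7 with Cor. 2.11); a contractible space is nonempty and path connected. [cite: Hatcher2002, Prop. 2.7 with Cor. 2.11] -/
theorem singularHomology.isIso_ε_of_contractibleSpace [ContractibleSpace X] :
    IsIso (singularHomology.ε R M X) :=
  singularHomology.isIso_ε_of_pathConnectedSpace R M

/-- The unit sphere `𝕊ⁿ ⊆ ℝⁿ⁺¹` as a metric sphere in `EuclideanSpace ℝ (Fin (n + 1))`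
(as in `Literature.Statements.SPC4.Wave0`). -/
local notation "𝕊 " n:arg => (Metric.sphere (0 : EuclideanSpace ℝ (Fin (n + 1))) 1)

/-- `Hₙ(𝕊ⁿ; M) ≅ M` for `n ≥ 1` (Hatcher 2002, Cor. 2.14). (For `n = 0`, `H₀(𝕊⁰; M) ≅ M ⊕ M`.) [cite: Hatcher2002, Cor. 2.14] -/
def nonempty_singularHomology_sphere_iso : Prop :=
  ∀ {n : ℕ} (_ : 1 ≤ n),
    Nonempty (singularHomology R M (𝕊 n) n ≅ ModuleCat.of R (ULift M))

/-- `Hₖ(𝕊ⁿ; M) = 0` for `k ≠ 0, n` (Hatcher 2002, Cor. 2.14). [cite: Hatcher2002, Cor. 2.14] -/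
def isZero_singularHomology_sphere : Prop :=
  ∀ {n k : ℕ} (_ : k ≠ 0) (_ : k ≠ n),
    IsZero (singularHomology R M (𝕊 n) k)

/-- `Hₙ(𝔻ⁿ, ∂𝔻ⁿ; M) ≅ M` for `n ≥ 1`, where `𝔻ⁿ` is the closed unit ball of
`EuclideanSpace ℝ (Fin n)` and `∂𝔻ⁿ = 𝕊ⁿ⁻¹` its boundary sphere (Hatcher 2002, Ex. 2.17 and the
long exact sequence of the pair, Lemma 2.19 ff.). [cite: Hatcher2002, Ex. 2.17] -/
def nonempty_relativeSingularHomology_closedBall_sphere_iso : Prop :=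
  ∀ {n : ℕ} (_ : 1 ≤ n),
    Nonempty (relativeSingularHomology R M (Metric.closedBall (0 : EuclideanSpace ℝ (Fin n)) 1)
      (Subtype.val ⁻¹' Metric.sphere (0 : EuclideanSpace ℝ (Fin n)) 1) n ≅
        ModuleCat.of R (ULift M))

end Literature.AlgebraicTopology.SingularHomology
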